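import Summits.BirchSwinnertonDyer.BirchSwinnertonDyer.Theses.BiquadraticEisensteinDescent
import Summits.BirchSwinnertonDyer.BirchSwinnertonDyer.Theorems.BiquadraticEisensteinDescentEisensteinHeartFlatCMInertBadKPrimeKatzLineFromFlat
import Summits.BirchSwinnertonDyer.BirchSwinnertonDyer.Theorems.BiquadraticEisensteinDescentEisensteinHeartFlatCMInertBadKPrimeRangeCharacter
import Summits.BirchSwinnertonDyer.BirchSwinnertonDyer.Theorems.BiquadraticEisensteinDescentEisensteinHeartFlatCMInertBadKPrimeRangeAvatar
import Summits.BirchSwinnertonDyer.BirchSwinnertonDyer.Theorems.BiquadraticEisensteinDescentEisensteinHeartFlatCMInertBadKPrimeRangeInfinite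
import HarnessLib

/-!
# Crux `EisensteinHeartFlatCMInertBadKPrime` (stmt-BirchSwinnertonDyer-21341) — line `hsieh_lambda`, skeleton v8.2

Lead-prover seat `bsd-wall-cm-bed-p1` g11 (2026-08-29). v7 (7a0fae088e9a9fa9) reshaped v6's single research stub `stub_V4R` along
the one seam every proof of the crux must cross — Hsieh's range
`R = {(χ, r) : χ everywhere-unramified of type (n, −n), n ≥ 1, r a p-adic avatar of χ through the anticyclotomic κ}` must be
non-empty, indeed INFINITE (the divisibility `∃ m, p^m·Ch ⊆ (G)` for EVERY `G` pinned only on a finite node set is false: add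
`H·∏(T − x_i)` to `G`; RANGE-NONEMPTINESS-w1g20, LEAD-G9 §6, INPUTS DELTA-85 rows P1/P2). v8 = v7 with both kernel stubs of v7
LANDED (p719262 `…RangeCharacter`, p719120 `…RangeAvatar`) and the infinitude made explicit:
* `stub_rangeCharacter` (R1, PROVED p719262): an everywhere-unramified Hecke character of type `(w_K, −w_K)` on any imaginary
  quadratic field (Weil's PROVED extension lemma `exists_isUnitary_infiniteIdeles_eq_unramified` with modulus `⊤`).
* `stub_rangeAvatar` (R2, PROVED p719120): from such a `Ψ`, for `p` odd and ANY anticyclotomic `κ`, `χ = Ψ^N (Ψ^N∘c̄)⁻¹` has a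
  `p`-adic avatar through `κ` (the p-general X11b/Three `LambdaSupply` toolkit: rank two + `apply_eq_one_of_anti`).
* `stub_rangeInfinite` (R3, PROVED p719685): a point `(χ, r)` of `R` has `r(γ)^q ≠ 1` for all `q ≥ 1` (`γ` a topological generator of
  `κ`), so `(χ^q, r^q)_{q ≥ 1}` are infinitely many points of `R` with distinct nodes (`…AvatarRigidity` + avatar rigidity + types).
* `hsiehRangeWitness` (glue) = R3 ∘ R2 ∘ R1: an explicit non-torsion point of `R` for the crux's `(K′, p, κ, γ, ι′)`.
* `stub_V4Rr` (RESEARCH, not benchable): v6's `stub_V4R` verbatim with ONE extra hypothesis after the `ι′`-clause — a NON-TORSION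
  point of `R` (so its prover holds an infinite range with nodes `u^q − 1` in one closed disc of radius `< 1`, the hypothesis of the
  tree's identity principle). Content: the λ-part Eisenstein divisibility on the Katz `K′`-line of `(L = K′·K_CM, Σ induced from
  K′)` for `ψ_W∘N_{L/K_CM}` on the niveau-2 tame branch — NOT IN PRINT (Hsieh JAMS 27 Thm 2 hyp (2) / BHTY25 hyp (ii) fail at Σ_p^c;
  LEAD-G2…G10-VERDICT; [ABL] acq-13180).
* `V4R_of_stubs` (glue): v6's `stub_V4R` from `stub_V4Rr` + `hsiehRangeWitness`; `EisensteinHeartFlatCMInertBadKPrime_of` = the lead's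
  `…KatzLineFromFlat.eisensteinHeartFlatCMInertBadKPrime_of_V4R` (p709284) applied to it — the route decl BY NAME, no named fact.
* RANGE RIGIDITY (helper, PROVED p720278 `…RangeRigidity`): `eq_of_hasValueAt_range` — a series is DETERMINED by its values on the range once a
  non-torsion point exists (identity principle on the nodes `u^q − 1`), so the `∀ G` of `stub_V4Rr` concerns ONE series per frame.
`lean check` (v8.2 = v8.1 + this docstring): rc 0, sorries 1 (`stub_V4Rr` — the research residue). BSD is not proved by any of this; 21341 is OPEN.
-/

set_option linter.dupNamespace false
set_option autoImplicit false

noncomputable section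

open scoped Classical NumberField

open WeierstrassCurve NumberField IsDedekindDomain Field PowerSeries
  Literature.NumberTheory.EllipticCurves Literature.NumberTheory.EllipticCurves.ModularForms
  Literature.NumberTheory.EllipticCurves.Rank1Residual
  Literature.NumberTheory.EllipticCurves.Hsieh2014
  Literature.NumberTheory.EllipticCurves.GreenbergSelmer
  Literature.NumberTheory.EllipticCurves.Module
  Literature.NumberTheory.EllipticCurves.IwasawaDual
  Literature.NumberTheory.GaloisRepresentations
  Summit.BirchSwinnertonDyer.Rank1Residual Summit.BirchSwinnertonDyer.Rank1Residual.X11b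
  Summit.BirchSwinnertonDyer.Rank1Residual.X11b.AcSelmer
  Summit.BirchSwinnertonDyer.BirchSwinnertonDyer.Theorems.BiquadraticEisensteinDescentDefs
  Summit.BirchSwinnertonDyer.BirchSwinnertonDyer.Theorems.BiquadraticEisensteinDescentEisensteinHeartFlatCMInertBadKPrimeSelmerTower
  Summit.BirchSwinnertonDyer.BirchSwinnertonDyer.Theorems.BiquadraticEisensteinDescentEisensteinHeartFlatCMInertBadKPrimeShapiroDatum
  Summit.BirchSwinnertonDyer.BirchSwinnertonDyer.Theorems.BiquadraticEisensteinDescentEisensteinHeartFlatCMInertBadKPrimeCMDatumAdapter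

namespace Summit.BirchSwinnertonDyer.BirchSwinnertonDyer.Cruxes.EisensteinHeartFlatCMInertBadKPrime.HsiehLambda

open Summit.BirchSwinnertonDyer.BirchSwinnertonDyer.Theses.BiquadraticEisensteinDescent

/-- STUB `stub_rangeCharacter` (R1 — KERNEL, PROVED p719262 `…RangeCharacter`; the idelic half of «Hsieh's range is non-empty»): every imaginary
quadratic field `K` carries a Hecke character `Ψ` of infinity type `(k, −k)` for some `k > 0` (tree convention
`HasInfinityType (fun _ ↦ k) (fun _ ↦ -k)`, i.e. `Ψ((x,1)) = ι(x)^{-k} \overline{ι(x)}^{k}`) which is UNRAMIFIED AT EVERY FINITE PLACE.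
RECIPE (all tree theorems, no fact): Weil's extension lemma `HeckeCharacter.exists_isUnitary_infiniteIdeles_eq_unramified`
(`Literature/…/CMTypeHeckeCharacter.lean`, PROVED) with modulus `𝔞 = ⊤` and the unitary archimedean character
`Φ = archUnitaryValue (-2 w_K) 0` (`exists_continuousMonoidHom_archUnitaryValue`, `w_K = NumberField.Units.torsionOrder K`): the unit
hypothesis holds for ALL units because units of an imaginary quadratic field are roots of unity (`u ^ w_K = 1`,
`HeckeCharacter.units_pow_torsionOrder_eq_one`, and `|ι u| = 1`, `LambdaSupply.apply_units_eq_one`); `(z/|z|)^{-2w} = z^{-w} z̄^{w}` gives the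
type `(w_K, −w_K)`; `¬ ⊤ ≤ v.asIdeal` for every prime `v` gives unramified everywhere. Template: the proof of
`Summit.BirchSwinnertonDyer.Rank1Residual.X11b.Three.LambdaSupply.exists_character_quotient_type_one` (X11b/Three/LambdaSupplyCharacters.lean
ll. 287–350) with `(p²)` replaced by `⊤` and `(-1, 0)` by `(-2w_K, 0)`. Why it might fail: it does not (Weil 1956 §1; de Shalit II.1.4). -/
theorem stub_rangeCharacter :
    ∀ (K : Type) [Field K] [NumberField K], IsImaginaryQuadratic K →
      ∃ (Ψ : HeckeCharacter K) (k : ℕ), 0 < k ∧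
        Ψ.HasInfinityType (fun _ ↦ (k : ℤ)) (fun _ ↦ -(k : ℤ)) ∧
        ∀ v : HeightOneSpectrum (𝓞 K), Ψ.IsUnramifiedAt v :=
  Summit.BirchSwinnertonDyer.BirchSwinnertonDyer.Theorems.BiquadraticEisensteinDescentEisensteinHeartFlatCMInertBadKPrimeRangeCharacter.stub_rangeCharacter

/-- STUB `stub_rangeAvatar` (R2 — KERNEL, PROVED p719120 `…RangeAvatar`; the Galois half of «Hsieh's range is non-empty»): for `K` imaginary
quadratic, `p` odd, `κ` ANY anticyclotomic `ℤ_p`-extension and `ι' : ℚ̄_p ≃ ℂ`, from one everywhere-unramified `Ψ` of type `(k, −k)`, `k > 0`,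
one gets an everywhere-unramified `χ` of type `(n, −n)`, `n > 0`, together with a `p`-adic avatar `r` (`IsPAdicAvatarOf ι' χ r`) that FACTORS
THROUGH `κ` (`FactorsThroughZp κ r`) — a point of Hsieh's range on the `K′`-line. RECIPE (all tree theorems, p-general; template = the proof of
`X11b.Three.LambdaSupply.exists_lambda_of_character`, X11b/Three/LambdaSupply.lean ll. 77–250, WITHOUT its twisting step): `c ∈ Γ_ℚ ∖ Γ_K`, `c² = 1`,
its lift `θ` (`ZpExtension.IndexTwo.exists_conjHom`), the rank-two spanning pair `Φ₀, Φ₁` (`LambdaSupply.exists_spanningPair`); Weil's character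
`a : Γ_K →* Eˣ` of `Ψ` (`LambdaSupply.exists_weilValued`); `N = n₁ M` with `a^{n₁}` principal-unit valued (`PadicUnits.exists_pow_mem_of_isOpen` +
`exists_principalUnits`) and `a^M = 1` on `ker Φ₀ ∩ ker Φ₁` (`LambdaSupply.pow_eq_one_of_forall_character`); `u = a^N`, `g = u/(u∘θ)` is anti-invariant,
principal-unit valued and trivial on `ker Φ₀ ∩ ker Φ₁`, hence KILLS `ker κ` (`LambdaSupply.apply_eq_one_of_anti` with `P` = principal units,
`PadicUnits.eq_one_of_mul_self_eq_one` for `p ≠ 2`); `χ := Ψ^N · (Ψ^N ∘ c̄)⁻¹` (type `(2Nk, −2Nk)` by `HasInfinityType.zpow'/galConj_complexConj/inv/mul'`,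
unramified everywhere by `IsUnramifiedAt.zpow'/inv'/mul'` + `isUnramifiedAt_galConj_iff`) has the avatar `e ∘ (ψ' (ψ'∘θ)⁻¹) = e ∘ ι_E∘g⁻¹`
(`isPAdicAvatarOf_pow`, `isPAdicAvatarOf_mul_galConj_inv_of_finrank_eq_two`), which factors through `κ` (`factorsThroughZp_unitsChar_iff`).
No class-number hypothesis is needed (torsion dies in the power `M`). Why it might fail: it does not (Greenberg 1987 §2; Washington §13.1). -/
theorem stub_rangeAvatar :
    ∀ (K : Type) [Field K] [NumberField K] (p : ℕ) [Fact p.Prime], IsImaginaryQuadratic K → p ≠ 2 →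
      ∀ (κ : ZpExtension K p), κ.IsAnticyclotomic → ∀ (ι' : PadicAlgCl p ≃+* ℂ) (Ψ : HeckeCharacter K) (k : ℕ), 0 < k →
        Ψ.HasInfinityType (fun _ ↦ (k : ℤ)) (fun _ ↦ -(k : ℤ)) →
        (∀ v : HeightOneSpectrum (𝓞 K), Ψ.IsUnramifiedAt v) →
        ∃ (χ : HeckeCharacter K) (n : ℕ) (r : FramedGaloisRep K (PadicAlgCl p) 1), 0 < n ∧
          (∀ v : HeightOneSpectrum (𝓞 K), χ.IsUnramifiedAt v) ∧
          χ.HasInfinityType (fun _ ↦ (n : ℤ)) (fun _ ↦ -(n : ℤ)) ∧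
          IsPAdicAvatarOf ι' χ r ∧ FactorsThroughZp κ r :=
  Summit.BirchSwinnertonDyer.BirchSwinnertonDyer.Theorems.BiquadraticEisensteinDescentEisensteinHeartFlatCMInertBadKPrimeRangeAvatar.stub_rangeAvatar

/-- STUB `stub_rangeInfinite` (R3 — KERNEL, PROVED p719685 `…RangeInfinite`; «a point of Hsieh's range is never torsion, so the range is INFINITE»): for
`K` imaginary quadratic, `κ` a `ℤ_p`-extension with topological generator `γ`, and a point `(χ, n, r)` of the range (χ everywhere
unramified of type `(n, −n)`, `n > 0`, `IsPAdicAvatarOf ι' χ r`, `FactorsThroughZp κ r`): `avatarValueAt r γ ^ q ≠ 1` for all `q > 0` — so the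
points `(χ^q, r^q)` of the range have pairwise distinct nodes `r(γ)^q − 1`. RECIPE (tree theorems): write `r = e ∘ ψ`
(`LambdaSupply.comp_symm_comp_eq`); if `ψ(γ)^q = 1` then `e ∘ ψ^q` factors through `κ` and is trivial at the unit-level `γ`, hence trivial
(`…AvatarRigidity.apply_eq_one_of_factorsThroughZp_of_isUnit`); then `χ^q` (avatar `e ∘ ψ^q`, `LambdaSupply.isPAdicAvatarOf_pow`) and `1` share
an avatar, so `χ^q = 1` (`LambdaSupply.eq_of_isPAdicAvatarOf_of_isPAdicAvatarOf`), contradicting the type `(qn, −qn)`, `qn ≠ 0`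
(`X11b.LambdaSupply.not_hasInfinityType_one_of_ne_zero`). Why it might fail: it does not. Necessary: the divisibility for every `G` pinned
on a FINITE node set is false (add `H·∏(T − x_i)` to `G`). -/
theorem stub_rangeInfinite :
    ∀ (K : Type) [Field K] [NumberField K] (p : ℕ) [Fact p.Prime], IsImaginaryQuadratic K →
      ∀ (κ : ZpExtension K p) (γ : Field.absoluteGaloisGroup K), κ.IsTopGenerator γ →
        ∀ (ι' : PadicAlgCl p ≃+* ℂ) (χ : HeckeCharacter K) (n : ℕ) (r : FramedGaloisRep K (PadicAlgCl p) 1), 0 < n →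
          (∀ v : HeightOneSpectrum (𝓞 K), χ.IsUnramifiedAt v) →
          χ.HasInfinityType (fun _ ↦ (n : ℤ)) (fun _ ↦ -(n : ℤ)) →
          IsPAdicAvatarOf ι' χ r → FactorsThroughZp κ r →
          ∀ q : ℕ, 0 < q → avatarValueAt r γ ^ q ≠ 1 :=
  Summit.BirchSwinnertonDyer.BirchSwinnertonDyer.Theorems.BiquadraticEisensteinDescentEisensteinHeartFlatCMInertBadKPrimeRangeInfinite.stub_rangeInfinite

/-- GLUE (kernel-checked): «Hsieh's range on the `K′`-line is INFINITE» — for `K` imaginary quadratic, `p` odd, ANY anticyclotomic `κ`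
with topological generator `γ` and any `ι'` there is an everywhere-unramified Hecke character `χ` of type `(n, −n)`, `n > 0`, with a `p`-adic
avatar `r` through `κ` whose value `r(γ)` is NOT a root of unity; = R3 ∘ R2 ∘ R1. All powers `(χ^q, r^q)` are again points of the range
(`LambdaSupply.isPAdicAvatarOf_pow`, `…RangeClassification.factorsThroughZp_unitsChar_mul`) with pairwise distinct nodes `r(γ)^q − 1`. This is
the latent input P1/P2 of INPUTS-LIST-1-v2 DELTA-85 made a theorem (R1, R2 landed: p719262, p719120). -/
theorem hsiehRangeWitness (K : Type) [Field K] [NumberField K] (p : ℕ) [Fact p.Prime] (hK : IsImaginaryQuadratic K) (hp : p ≠ 2)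
    (κ : ZpExtension K p) (hκ : κ.IsAnticyclotomic) (γ : Field.absoluteGaloisGroup K) (hγ : κ.IsTopGenerator γ)
    (ι' : PadicAlgCl p ≃+* ℂ) :
    ∃ (χ : HeckeCharacter K) (n : ℕ) (r : FramedGaloisRep K (PadicAlgCl p) 1), 0 < n ∧
      (∀ v : HeightOneSpectrum (𝓞 K), χ.IsUnramifiedAt v) ∧
      χ.HasInfinityType (fun _ ↦ (n : ℤ)) (fun _ ↦ -(n : ℤ)) ∧
      IsPAdicAvatarOf ι' χ r ∧ FactorsThroughZp κ r ∧ ∀ q : ℕ, 0 < q → avatarValueAt r γ ^ q ≠ 1 := by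
  obtain ⟨Ψ, k, hk, hΨt, hΨu⟩ := stub_rangeCharacter K hK
  obtain ⟨χ, n, r, hn, hu, ht, hav, hfac⟩ := stub_rangeAvatar K p hK hp κ hκ ι' Ψ k hk hΨt hΨu
  exact ⟨χ, n, r, hn, hu, ht, hav, hfac, stub_rangeInfinite K p hK κ γ hγ ι' χ n r hn hu ht hav hfac⟩

/-- STUB `stub_V4Rr` (XL — THE INPUT, RESEARCH, NOT BENCHABLE; held by the lead): v6's `stub_V4R` VERBATIM with ONE extra hypothesis inserted
after the `ι'`-compatibility clause — a NON-TORSION POINT of Hsieh's range `(∃ χ n r, 0 < n ∧ χ unramified everywhere ∧ type (n,−n) ∧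
IsPAdicAvatarOf ι' χ r ∧ FactorsThroughZp κ r ∧ ∀ q > 0, avatarValueAt r γ ^ q ≠ 1)` (v8: the non-torsion clause is new w.r.t. v7). Honest
reading: `stub_V4R` (and the crux) are FALSE on a finite range (`G + H·∏(T − x_i)` qualifies), so every proof of them uses the range's
infinitude; v8 makes that use explicit and discharges it in the kernel (`hsiehRangeWitness` = R3 ∘ R2 ∘ R1), leaving here exactly the research
content: the λ-part Eisenstein divisibility on the Katz `K′`-line of `(L = K′·K_CM, Σ induced from K′)` for `ψ_W∘N_{L/K_CM}` on the niveau-2 tame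
branch — NOT IN PRINT (Hsieh JAMS 27 Thm 2 hyp (2) / BHTY25 hyp (ii) fail at Σ_p^c; [ABL] acq-13180). `stub_V4R ⟸ stub_V4Rr ∧ hsiehRangeWitness`
(`V4R_of_stubs`); `stub_V4Rr ⟸ stub_V4R` trivially. First tool for its prover: `…RangeRigidity.eq_of_hasValueAt_range` (p720278) — with the
non-torsion point in hand, `G` is UNIQUE for its frame (identity principle on the nodes `r(γ)^q − 1`). -/
theorem stub_V4Rr :
    ∀ (W : WeierstrassCurve ℚ) [W.IsElliptic] [W.IsGloballyMinimal] (p : ℕ) [Fact p.Prime]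
      [NeZero (W.conductorNorm ℤ)] (K : Type) [Field K] [NumberField K],
      W.HasCM → 5 ≤ p → CMInert W p → ¬ Good W p →
      IsImaginaryQuadratic K → SatisfiesHeegnerHypothesis (W.conductorNorm ℤ) K →
      4 < (NumberField.discr K).natAbs → ¬ p ∣ NumberField.classNumber K →
      ∀ (κ : ZpExtension K p), κ.IsAnticyclotomic →
        ∀ (γ : Field.absoluteGaloisGroup K) [Fact (κ.IsTopGenerator γ)]
          (𝔭 : HeightOneSpectrum (𝓞 K)), ((p : ℕ) : 𝓞 K) ∈ 𝔭.asIdeal →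
          𝔭.asIdeal.ramificationIdx (𝓞 ℚ) = 1 → 𝔭.asIdeal.inertiaDeg (𝓞 ℚ) = 1 →
          ∀ (f : CuspForm (CongruenceSubgroup.Gamma0 (W.conductorNorm ℤ)) 2), IsNewformOf W f →
            ∀ (ι' : PadicAlgCl p ≃+* ℂ),
              (∀ (w : InfinitePlace K) (k : 𝓞 K), k ∈ 𝔭.asIdeal ↔ ‖ι'.symm (w.embedding (k : K))‖ < 1) →
              (∃ (χ : HeckeCharacter K) (n : ℕ) (r : FramedGaloisRep K (PadicAlgCl p) 1), 0 < n ∧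
                  (∀ v : HeightOneSpectrum (𝓞 K), χ.IsUnramifiedAt v) ∧
                  χ.HasInfinityType (fun _ ↦ (n : ℤ)) (fun _ ↦ -(n : ℤ)) ∧
                  IsPAdicAvatarOf ι' χ r ∧ FactorsThroughZp κ r ∧ ∀ q : ℕ, 0 < q → avatarValueAt r γ ^ q ≠ 1) →
                  ∀ (𝔭' : HeightOneSpectrum (𝓞 K)), ((p : ℕ) : 𝓞 K) ∈ 𝔭'.asIdeal → 𝔭' ≠ 𝔭 →
                  Module.IsTorsion (IwasawaAlgebra p) (XAc (W.baseChange K) p κ 𝔭' ∅ γ) →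
                  ∀ (L : Type) [Field L] [NumberField L] [Algebra K L] [IsGalois K L]
                    (Sp S T : Finset (HeightOneSpectrum (𝓞 L))) (lam : HeckeCharacter L) (ϑ : L) (CK : ℂ)
                    (Ω : InfinitePlace L → ℂ) (ΩpK : InfinitePlace L → ℂ_[p]) (G : PowerSeries 𝓞_ℂ_[p])
                    (w₁ w₂ : InfinitePlace L) (cL cL' : ℂ),
                    w₁ ≠ w₂ → (∀ w : InfinitePlace L, w = w₁ ∨ w = w₂) →
                    (∀ (χ : HeckeCharacter K) (n : ℕ), 0 < n → (∀ v : HeightOneSpectrum (𝓞 K), χ.IsUnramifiedAt v) →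
                      χ.HasInfinityType (fun _ ↦ (n : ℤ)) (fun _ ↦ -(n : ℤ)) →
                      KatzCM.HasKatzType ι' Sp (lam * χ.compRelNorm L) 1 (fun w ↦ if w = w₁ then n else n - 1)) →
                    (∀ (χ : HeckeCharacter K) (n : ℕ), 0 < n → (∀ v : HeightOneSpectrum (𝓞 K), χ.IsUnramifiedAt v) →
                      χ.HasInfinityType (fun _ ↦ (n : ℤ)) (fun _ ↦ -(n : ℤ)) →
                      LFunction.HasEntireContinuation (heckeLFunction (lam * χ.compRelNorm L))) →
                    cL ≠ 0 → cL' ≠ 0 →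
                    (∀ (χ : HeckeCharacter K) (n : ℕ), 0 < n → (∀ v : HeightOneSpectrum (𝓞 K), χ.IsUnramifiedAt v) →
                      χ.HasInfinityType (fun _ ↦ (n : ℤ)) (fun _ ↦ -(n : ℤ)) →
                      ∀ hL : LFunction.HasEntireContinuation (heckeLFunction (lam * χ.compRelNorm L)),
                        hL.continuation 0 = cL * cL' ^ n * rankinSelbergValueHecke f χ 1) →
                    (∀ w ∈ S ∪ KatzCM.primesOver L p, ¬ lam.IsUnramifiedAt w) →
                    (∀ w ∈ Sp ∪ T, ¬ lam.IsUnramifiedAt w) →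
                    CK ≠ 0 → (∀ w, Ω w ≠ 0) → (∀ w, (KatzCM.embeddingAt ι' Sp w ϑ).im ≠ 0) → (∀ w, ΩpK w ≠ 0) →
                    (∀ (χ : HeckeCharacter K) (n : ℕ), 0 < n → (∀ v : HeightOneSpectrum (𝓞 K), χ.IsUnramifiedAt v) →
                      χ.HasInfinityType (fun _ ↦ (n : ℤ)) (fun _ ↦ -(n : ℤ)) →
                      ∀ r : FramedGaloisRep K (PadicAlgCl p) 1, IsPAdicAvatarOf ι' χ r → FactorsThroughZp κ r →
                      ∀ hL : LFunction.HasEntireContinuation (heckeLFunction (lam * χ.compRelNorm L)),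
                        IntSeries.HasValueAt G (avatarValueAt r γ - 1)
                          ((((ι'.symm (KatzCM.interpolationValue ι' Sp S T lam (χ.compRelNorm L) 1
                              (fun w ↦ if w = w₁ then n else n - 1) ϑ CK Ω (hL.continuation 0))) : PadicAlgCl p) : ℂ_[p]) *
                            ∏ w, ΩpK w ^ (1 + 2 * (fun w ↦ if w = w₁ then n else n - 1) w))) →
                  ∀ (d₀ : ℤ) (r : AlgebraicClosure K) (ψ : (W.baseChange K).geomPoints →+ (W.baseChange K).geomPoints),
                    r * r = algebraMap K (AlgebraicClosure K) (d₀ : K) →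
                    r ∉ Set.range (algebraMap K (AlgebraicClosure K)) →
                    (∀ y : ZMod p, y * y ≠ PadicInt.toZMod ((d₀ : ℤ) : ℤ_[p])) →
                    (∀ σ : absoluteGaloisGroup K, σ • r = r → ∀ P : (W.baseChange K).geomPoints, σ • ψ P = ψ (σ • P)) →
                    (∀ σ : absoluteGaloisGroup K, σ • r = -r → ∀ P : (W.baseChange K).geomPoints, σ • ψ P = -ψ (σ • P)) →
                    (∀ P, ψ (ψ P) = d₀ • P) →
                  ∀ (U : Subgroup (absoluteGaloisGroup K)) [U.Normal], (∀ σ, σ ∈ U ↔ σ • r = r) →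
                  ∀ (φ : (W.baseChange K).geomPrimaryTorsion p →+ (W.baseChange K).geomPrimaryTorsion p)
                    (_ : ∀ m, ((φ m : (W.baseChange K).geomPrimaryTorsion p) : (W.baseChange K).geomPoints) = ψ m)
                    (hφH' : ∀ (x : (κ.kerSubgroup ⊓ U : Subgroup (absoluteGaloisGroup K)))
                      (m : (W.baseChange K).geomPrimaryTorsion p), φ (x • m) = x • φ m)
                    (hφU : ∀ σ ∈ U, ∀ m : (W.baseChange K).geomPrimaryTorsion p, φ (σ • m) = σ • φ m)
                    (hφU' : ∀ σ, σ ∉ U → ∀ m : (W.baseChange K).geomPrimaryTorsion p, φ (σ • m) = -(σ • φ m))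
                    (hφ2 : ∀ m, φ (φ m) = d₀ • m)
                    (γ' : absoluteGaloisGroup K) (_ : κ.IsTopGenerator γ') (_ : γ' ∈ U)
                    (f₁ : AddMonoid.End (selmerOver (κ.kerSubgroup ⊓ U) ((W.baseChange K).geomPrimaryTorsion p) p 𝔭' ∅))
                    (_hf : ∀ s, ((f₁ s : selmerOver (κ.kerSubgroup ⊓ U) ((W.baseChange K).geomPrimaryTorsion p) p 𝔭' ∅) :
                      subgroupH1 (κ.kerSubgroup ⊓ U) ((W.baseChange K).geomPrimaryTorsion p)) =
                        conjH1 (κ.kerSubgroup ⊓ U) ((W.baseChange K).geomPrimaryTorsion p) γ' s)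
                    (h : IsLocNil p (f₁ - 1))
                    (δ : LocNilDual (selmerOver (κ.kerSubgroup ⊓ U) ((W.baseChange K).geomPrimaryTorsion p) p 𝔭' ∅) f₁ h
                      →ₗ[IwasawaAlgebra p]
                      LocNilDual (selmerOver (κ.kerSubgroup ⊓ U) ((W.baseChange K).geomPrimaryTorsion p) p 𝔭' ∅) f₁ h)
                    (hδ : ∀ (x : LocNilDual (selmerOver (κ.kerSubgroup ⊓ U) ((W.baseChange K).geomPrimaryTorsion p) p 𝔭' ∅) f₁ h)
                      (s t : selmerOver (κ.kerSubgroup ⊓ U) ((W.baseChange K).geomPrimaryTorsion p) p 𝔭' ∅),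
                      (t : subgroupH1 (κ.kerSubgroup ⊓ U) ((W.baseChange K).geomPrimaryTorsion p)) =
                        resH1Hom (ContinuousMonoidHom.id _) φ hφH'
                          (s : subgroupH1 (κ.kerSubgroup ⊓ U) ((W.baseChange K).geomPrimaryTorsion p)) → δ x s = x t)
                    (b : Module.Basis (Fin 2) ℤ_[p]
                      (AdjoinRoot (Polynomial.X ^ 2 - Polynomial.C ((d₀ : ℤ) : ℤ_[p]) : Polynomial ℤ_[p]))) (hb0 : b 0 = 1)
                    (hb1 : b 1 * b 1 = algebraMap ℤ_[p]
                      (AdjoinRoot (Polynomial.X ^ 2 - Polynomial.C ((d₀ : ℤ) : ℤ_[p]) : Polynomial ℤ_[p])) ((d₀ : ℤ) : ℤ_[p]))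
                    (ι : AdjoinRoot (Polynomial.X ^ 2 - Polynomial.C ((d₀ : ℤ) : ℤ_[p]) : Polynomial ℤ_[p]) →+* 𝓞_ℂ_[p])
                    (_ : ι.comp (algebraMap ℤ_[p] _) = R1.toCpInt p),
                    ∃ m : ℕ, ∀ x ∈ (charIdeal (PowerSeries
                        (AdjoinRoot (Polynomial.X ^ 2 - Polynomial.C ((d₀ : ℤ) : ℤ_[p]) : Polynomial ℤ_[p])))
                        (WithQuadratic (LocNilDual (selmerOver (κ.kerSubgroup ⊓ U) ((W.baseChange K).geomPrimaryTorsion p)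
                          p 𝔭' ∅) f₁ h) b hb0 hb1 δ
                          (delta_sq (W.baseChange K) κ 𝔭' ∅ U φ hφH' hφU hφU' d₀ hφ2 f₁ h δ hδ))).map (PowerSeries.map ι),
                      (PowerSeries.C ((p : ℕ) : 𝓞_ℂ_[p]) : PowerSeries 𝓞_ℂ_[p]) ^ m * x ∈ Ideal.span {G} := by
  sorry

/-- GLUE (kernel-checked): v6's `stub_V4R` from `stub_V4Rr` and the range witness (`hsiehRangeWitness`, `p ≠ 2` from `5 ≤ p`, `γ` from the `Fact`). -/
theorem V4R_of_stubs :
    ∀ (W : WeierstrassCurve ℚ) [W.IsElliptic] [W.IsGloballyMinimal] (p : ℕ) [Fact p.Prime]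
      [NeZero (W.conductorNorm ℤ)] (K : Type) [Field K] [NumberField K],
      W.HasCM → 5 ≤ p → CMInert W p → ¬ Good W p →
      IsImaginaryQuadratic K → SatisfiesHeegnerHypothesis (W.conductorNorm ℤ) K →
      4 < (NumberField.discr K).natAbs → ¬ p ∣ NumberField.classNumber K →
      ∀ (κ : ZpExtension K p), κ.IsAnticyclotomic →
        ∀ (γ : Field.absoluteGaloisGroup K) [Fact (κ.IsTopGenerator γ)]
          (𝔭 : HeightOneSpectrum (𝓞 K)), ((p : ℕ) : 𝓞 K) ∈ 𝔭.asIdeal →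
          𝔭.asIdeal.ramificationIdx (𝓞 ℚ) = 1 → 𝔭.asIdeal.inertiaDeg (𝓞 ℚ) = 1 →
          ∀ (f : CuspForm (CongruenceSubgroup.Gamma0 (W.conductorNorm ℤ)) 2), IsNewformOf W f →
            ∀ (ι' : PadicAlgCl p ≃+* ℂ),
              (∀ (w : InfinitePlace K) (k : 𝓞 K), k ∈ 𝔭.asIdeal ↔ ‖ι'.symm (w.embedding (k : K))‖ < 1) →
                  ∀ (𝔭' : HeightOneSpectrum (𝓞 K)), ((p : ℕ) : 𝓞 K) ∈ 𝔭'.asIdeal → 𝔭' ≠ 𝔭 →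
                  Module.IsTorsion (IwasawaAlgebra p) (XAc (W.baseChange K) p κ 𝔭' ∅ γ) →
                  ∀ (L : Type) [Field L] [NumberField L] [Algebra K L] [IsGalois K L]
                    (Sp S T : Finset (HeightOneSpectrum (𝓞 L))) (lam : HeckeCharacter L) (ϑ : L) (CK : ℂ)
                    (Ω : InfinitePlace L → ℂ) (ΩpK : InfinitePlace L → ℂ_[p]) (G : PowerSeries 𝓞_ℂ_[p])
                    (w₁ w₂ : InfinitePlace L) (cL cL' : ℂ),
                    w₁ ≠ w₂ → (∀ w : InfinitePlace L, w = w₁ ∨ w = w₂) →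
                    (∀ (χ : HeckeCharacter K) (n : ℕ), 0 < n → (∀ v : HeightOneSpectrum (𝓞 K), χ.IsUnramifiedAt v) →
                      χ.HasInfinityType (fun _ ↦ (n : ℤ)) (fun _ ↦ -(n : ℤ)) →
                      KatzCM.HasKatzType ι' Sp (lam * χ.compRelNorm L) 1 (fun w ↦ if w = w₁ then n else n - 1)) →
                    (∀ (χ : HeckeCharacter K) (n : ℕ), 0 < n → (∀ v : HeightOneSpectrum (𝓞 K), χ.IsUnramifiedAt v) →
                      χ.HasInfinityType (fun _ ↦ (n : ℤ)) (fun _ ↦ -(n : ℤ)) →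
                      LFunction.HasEntireContinuation (heckeLFunction (lam * χ.compRelNorm L))) →
                    cL ≠ 0 → cL' ≠ 0 →
                    (∀ (χ : HeckeCharacter K) (n : ℕ), 0 < n → (∀ v : HeightOneSpectrum (𝓞 K), χ.IsUnramifiedAt v) →
                      χ.HasInfinityType (fun _ ↦ (n : ℤ)) (fun _ ↦ -(n : ℤ)) →
                      ∀ hL : LFunction.HasEntireContinuation (heckeLFunction (lam * χ.compRelNorm L)),
                        hL.continuation 0 = cL * cL' ^ n * rankinSelbergValueHecke f χ 1) →
                    (∀ w ∈ S ∪ KatzCM.primesOver L p, ¬ lam.IsUnramifiedAt w) →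
                    (∀ w ∈ Sp ∪ T, ¬ lam.IsUnramifiedAt w) →
                    CK ≠ 0 → (∀ w, Ω w ≠ 0) → (∀ w, (KatzCM.embeddingAt ι' Sp w ϑ).im ≠ 0) → (∀ w, ΩpK w ≠ 0) →
                    (∀ (χ : HeckeCharacter K) (n : ℕ), 0 < n → (∀ v : HeightOneSpectrum (𝓞 K), χ.IsUnramifiedAt v) →
                      χ.HasInfinityType (fun _ ↦ (n : ℤ)) (fun _ ↦ -(n : ℤ)) →
                      ∀ r : FramedGaloisRep K (PadicAlgCl p) 1, IsPAdicAvatarOf ι' χ r → FactorsThroughZp κ r →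
                      ∀ hL : LFunction.HasEntireContinuation (heckeLFunction (lam * χ.compRelNorm L)),
                        IntSeries.HasValueAt G (avatarValueAt r γ - 1)
                          ((((ι'.symm (KatzCM.interpolationValue ι' Sp S T lam (χ.compRelNorm L) 1
                              (fun w ↦ if w = w₁ then n else n - 1) ϑ CK Ω (hL.continuation 0))) : PadicAlgCl p) : ℂ_[p]) *
                            ∏ w, ΩpK w ^ (1 + 2 * (fun w ↦ if w = w₁ then n else n - 1) w))) →
                  ∀ (d₀ : ℤ) (r : AlgebraicClosure K) (ψ : (W.baseChange K).geomPoints →+ (W.baseChange K).geomPoints),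
                    r * r = algebraMap K (AlgebraicClosure K) (d₀ : K) →
                    r ∉ Set.range (algebraMap K (AlgebraicClosure K)) →
                    (∀ y : ZMod p, y * y ≠ PadicInt.toZMod ((d₀ : ℤ) : ℤ_[p])) →
                    (∀ σ : absoluteGaloisGroup K, σ • r = r → ∀ P : (W.baseChange K).geomPoints, σ • ψ P = ψ (σ • P)) →
                    (∀ σ : absoluteGaloisGroup K, σ • r = -r → ∀ P : (W.baseChange K).geomPoints, σ • ψ P = -ψ (σ • P)) →
                    (∀ P, ψ (ψ P) = d₀ • P) →
                  ∀ (U : Subgroup (absoluteGaloisGroup K)) [U.Normal], (∀ σ, σ ∈ U ↔ σ • r = r) →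
                  ∀ (φ : (W.baseChange K).geomPrimaryTorsion p →+ (W.baseChange K).geomPrimaryTorsion p)
                    (_ : ∀ m, ((φ m : (W.baseChange K).geomPrimaryTorsion p) : (W.baseChange K).geomPoints) = ψ m)
                    (hφH' : ∀ (x : (κ.kerSubgroup ⊓ U : Subgroup (absoluteGaloisGroup K)))
                      (m : (W.baseChange K).geomPrimaryTorsion p), φ (x • m) = x • φ m)
                    (hφU : ∀ σ ∈ U, ∀ m : (W.baseChange K).geomPrimaryTorsion p, φ (σ • m) = σ • φ m)
                    (hφU' : ∀ σ, σ ∉ U → ∀ m : (W.baseChange K).geomPrimaryTorsion p, φ (σ • m) = -(σ • φ m))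
                    (hφ2 : ∀ m, φ (φ m) = d₀ • m)
                    (γ' : absoluteGaloisGroup K) (_ : κ.IsTopGenerator γ') (_ : γ' ∈ U)
                    (f₁ : AddMonoid.End (selmerOver (κ.kerSubgroup ⊓ U) ((W.baseChange K).geomPrimaryTorsion p) p 𝔭' ∅))
                    (_hf : ∀ s, ((f₁ s : selmerOver (κ.kerSubgroup ⊓ U) ((W.baseChange K).geomPrimaryTorsion p) p 𝔭' ∅) :
                      subgroupH1 (κ.kerSubgroup ⊓ U) ((W.baseChange K).geomPrimaryTorsion p)) =
                        conjH1 (κ.kerSubgroup ⊓ U) ((W.baseChange K).geomPrimaryTorsion p) γ' s)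
                    (h : IsLocNil p (f₁ - 1))
                    (δ : LocNilDual (selmerOver (κ.kerSubgroup ⊓ U) ((W.baseChange K).geomPrimaryTorsion p) p 𝔭' ∅) f₁ h
                      →ₗ[IwasawaAlgebra p]
                      LocNilDual (selmerOver (κ.kerSubgroup ⊓ U) ((W.baseChange K).geomPrimaryTorsion p) p 𝔭' ∅) f₁ h)
                    (hδ : ∀ (x : LocNilDual (selmerOver (κ.kerSubgroup ⊓ U) ((W.baseChange K).geomPrimaryTorsion p) p 𝔭' ∅) f₁ h)
                      (s t : selmerOver (κ.kerSubgroup ⊓ U) ((W.baseChange K).geomPrimaryTorsion p) p 𝔭' ∅),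
                      (t : subgroupH1 (κ.kerSubgroup ⊓ U) ((W.baseChange K).geomPrimaryTorsion p)) =
                        resH1Hom (ContinuousMonoidHom.id _) φ hφH'
                          (s : subgroupH1 (κ.kerSubgroup ⊓ U) ((W.baseChange K).geomPrimaryTorsion p)) → δ x s = x t)
                    (b : Module.Basis (Fin 2) ℤ_[p]
                      (AdjoinRoot (Polynomial.X ^ 2 - Polynomial.C ((d₀ : ℤ) : ℤ_[p]) : Polynomial ℤ_[p]))) (hb0 : b 0 = 1)
                    (hb1 : b 1 * b 1 = algebraMap ℤ_[p]
                      (AdjoinRoot (Polynomial.X ^ 2 - Polynomial.C ((d₀ : ℤ) : ℤ_[p]) : Polynomial ℤ_[p])) ((d₀ : ℤ) : ℤ_[p]))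
                    (ι : AdjoinRoot (Polynomial.X ^ 2 - Polynomial.C ((d₀ : ℤ) : ℤ_[p]) : Polynomial ℤ_[p]) →+* 𝓞_ℂ_[p])
                    (_ : ι.comp (algebraMap ℤ_[p] _) = R1.toCpInt p),
                    ∃ m : ℕ, ∀ x ∈ (charIdeal (PowerSeries
                        (AdjoinRoot (Polynomial.X ^ 2 - Polynomial.C ((d₀ : ℤ) : ℤ_[p]) : Polynomial ℤ_[p])))
                        (WithQuadratic (LocNilDual (selmerOver (κ.kerSubgroup ⊓ U) ((W.baseChange K).geomPrimaryTorsion p)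
                          p 𝔭' ∅) f₁ h) b hb0 hb1 δ
                          (delta_sq (W.baseChange K) κ 𝔭' ∅ U φ hφH' hφU hφU' d₀ hφ2 f₁ h δ hδ))).map (PowerSeries.map ι),
                      (PowerSeries.C ((p : ℕ) : 𝓞_ℂ_[p]) : PowerSeries 𝓞_ℂ_[p]) ^ m * x ∈ Ideal.span {G} := by
  intro W _ _ p _ _ K _ _ hCM hp5 hIn hBad hK hHeeg hd hh κ hκ γ _ 𝔭 h𝔭 he hf1 f hf ι' hι'
  exact stub_V4Rr W p K hCM hp5 hIn hBad hK hHeeg hd hh κ hκ γ 𝔭 h𝔭 he hf1 f hf ι' hι'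
    (hsiehRangeWitness K p hK (by omega) κ hκ γ (Fact.out) ι')

/-- COMPOSITION (kernel-checked): the crux `EisensteinHeartFlatCMInertBadKPrime` — THE ROUTE DECL BY NAME — from the stubs: `V4R_of_stubs`
(= `stub_V4Rr` + `stub_rangeInfinite` ∘ `stub_rangeAvatar` ∘ `stub_rangeCharacter`) fed to the lead's `…KatzLineFromFlat.eisensteinHeartFlatCMInertBadKPrime_of_V4R`
(g7: `[√d₀]` datum p621092 → `U = Stab(r)` → CM-datum adapter → tied frame data p708309 → constants making the crux's `Q` an admissible Katz line
series on the range (p708019, p708563, KatzLineFromFlat) → V4R at `G := Q`). No named fact, no print input. -/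
theorem EisensteinHeartFlatCMInertBadKPrime_of : EisensteinHeartFlatCMInertBadKPrime :=
  Summit.BirchSwinnertonDyer.BirchSwinnertonDyer.Theorems.BiquadraticEisensteinDescentEisensteinHeartFlatCMInertBadKPrimeKatzLineFromFlat.eisensteinHeartFlatCMInertBadKPrime_of_V4R
    V4R_of_stubs

end Summit.BirchSwinnertonDyer.BirchSwinnertonDyer.Cruxes.EisensteinHeartFlatCMInertBadKPrime.HsiehLambda

end
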